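import Literature.NumberTheory.LFunctions.Zhang2022.Section3Lemma32Subconvex
import Literature.NumberTheory.LFunctions.Zhang2022.Section3Lemma36Input
import HarnessLib

/-!
# Zhang (2022) §3: the printed majorant `|ς(n)| ≤ ν(n)τ₂(n)` and the input of Lemma 3.6 by the
# PRINTED route (Lemma 3.2, conditional on an `L`-size bound), side by side with the input-free route

Topic `Literature/NumberTheory/LFunctions/Zhang2022` (Landau–Siegel autopsy tree; verdict-neutral).
Y. Zhang, *Discrete mean estimates and the Landau–Siegel zero*, arXiv:2211.02515v1 — **an unrefereed
manuscript, a claimed result under adjudication** (audit + repair census of arXiv:2211.02515; no claim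
about Landau–Siegel is made here) — §3, proof of Lemma 3.6 [p. 7]:

> "`ς(n) = ∑_{n = lm, l, m ≤ D⁴} ν(l)υ(m)` … `|ς(n)| ≤ ∑_{n = lm} ν(l)|υ(m)| ≤ ν(n)τ₂(n)`.
> By Cauchy's inequality, the first assertion of Lemma 3.2 and Lemma 3.1 …"

(`ν = 1 ∗ χ`, `υ = μ ∗ μχ`, `τ₂ = τ` the divisor function; Lemma 3.2 is the eight-`L`-factor moment
bound `∑_{D⁴ < n ≤ D⁸} ν(n)²τ₂(n)²/n ≪ 𝓛⁻²⁰⁰⁷` under (A), whose sketched proof consumes a subconvex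
bound for `L(s,χ)` — the cell's flag F7.)  This file kernel-checks the displayed MAJORANT and closes
the manuscript's OWN route to the quantity `E = ∑_{D⁴ < n ≤ D⁸} ς(n)²/n` that Lemma 3.6 consumes:

* `upsAbs χ = |υ|` and `sigmaMajorant χ = ν ∗ |υ|` as real arithmetic functions (for a real completely
  multiplicative `χ` on `ℕ` with `χ(1) = 1`, `|χ| ≤ 1` — e.g. `DirichletAbel.reChar` of a quadratic
  Dirichlet character); both are multiplicative;
* `sigmaMajorant_prime_pow_le` — at a prime power, `(ν ∗ |υ|)(pᵏ) ≤ (k+1)·ν(pᵏ)` (with `c = χ(p)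
  ∈ [−1, 1]`: `|υ(p)| = 1 + c`, `|υ(p²)| = |c|`, `υ(pʲ) = 0` for `j ≥ 3`; for `c < 0` the left side
  equals `2ν(pᵏ)`, for `c ≥ 0` it is at most `4ν(pᵏ)` and `k = 1, 2` are checked by hand — at a split
  prime `c = 1` this is `4k ≤ (k+1)²`);
* `sigmaMajorant_le_card_mul_nuOf` — **`(ν ∗ |υ|)(n) ≤ τ(n)ν(n)` for all `n`** (comparison of
  multiplicative functions from prime powers, the tree's `abs_le_of_isMultiplicative`);
* `abs_sigmaTrunc_le_card_mul_nuOf` — **the printed majorant `|ς(n)| ≤ τ(n)ν(n)`** (for every cut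
  `Y` and every `n`; the truncation only drops terms, and `ν ≥ 0`), hence
  `sum_sigmaTrunc_sq_div_le_sum_card_sq_mul_nuOf_sq`: `∑_{n∈S} ς(n)²/n ≤ ∑_{n∈S} τ(n)²ν(n)²/n` on any
  finite set `S`, and for a quadratic Dirichlet character `χ` mod `D`
  (`nuOf (reChar χ) n² = ‖ν_χ(n)‖²`, `Lemma36Input.nuOf_reChar_sq_eq`) the right side is LITERALLY the
  left side of the tree's printed Lemma 3.2 (`Lemma32Cond.lemma_3_2_conditional`);
* **`lemma_3_6_input_printed_of_LBound` / `_of_halfLineBound` / `_of_burgessShape`** — the input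
  `E ≤ C·𝓛⁻²⁰⁰⁷` on `D⁴ < n ≤ D⁸` by the manuscript's route: majorant + printed Lemma 3.2, hence
  CONDITIONAL on the `L`-size binder of `Section3Lemma32Conditional` (`LBound χ κ b C_L`, `κ < 1/8`)
  resp. of `Section3Lemma32Subconvex` (`HalfLineBound χ μ b C₀`, any critical-line exponent
  `0 ≤ μ < ¼`; `BurgessShape χ ε C`, the printed shape of [IwaniecKowalski2004, Thm 12.9], which is NOT
  asserted anywhere in the tree);
* `lemma_3_6_input_two_routes` — the two routes to the SAME inequality recorded side by side: the
  tree's input-free `Lemma36Input.lemma_3_6_input'` (ALT-1 variant A11: `ν ∗ υ = δ`, Cauchy, the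
  four-factor moment `Section3Lemma32Flat`, no `L`-size hypothesis) and the printed route of this file
  (hypothesis `HalfLineBound`).

WHAT THIS SAYS FOR THE CELL (census note ALT1-R2, flag F7, rows T-ALT1b / T-ALT1h; repair-census V17,
all verdict-neutral): the sentence "the subconvex input of Lemma 3.2 is load-bearing for the ROUTE
`|ς| ≤ ντ₂`, not for Lemma 3.6" now has both of its halves as tree theorems with identical
conclusions — the printed route carries the binder, the A11 route does not.  Nothing here bears on the
located gap of the manuscript ((8.24), `Section8Certificate.not_ineq824`), which is downstream of §3 and
independent of every analytic input.  No statement about the manuscript's Theorems 1–2 is made or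
implied.

## References

* Y. Zhang, arXiv:2211.02515 (2022), §3, Lemmas 3.2, 3.6. [cite: Zhang2022LandauSiegel, §3, Lemma 3.6]
* H. Iwaniec, E. Kowalski, *Analytic Number Theory* (2004), Thm 12.9 (Burgess).
  [cite: IwaniecKowalski2004, Thm 12.9]
-/

noncomputable section

open ArithmeticFunction Finset

namespace Literature.NumberTheory.LFunctions.Zhang2022.SigmaMajorant

open Literature.NumberTheory.LFunctions.Zhang2022.Lemma36Input (reChar_mul_all nuOf_reChar_sq_eq
  lemma_3_6_input')
open Literature.NumberTheory.LFunctions.Zhang2022.Lemma32Cond (LBound lemma_3_2_conditional)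
open Literature.NumberTheory.LFunctions.Zhang2022.Lemma32Subconvex (HalfLineBound BurgessShape
  lemma_3_2_of_halfLineBound lemma_3_2_of_burgessShape)
open Literature.NumberTheory.LFunctions.DirichletAbel (reChar reChar_one abs_reChar_le_one)

section RealMultiplicative

variable (χ : ArithmeticFunction ℝ)

/-! ### `|υ|` and the majorant `ν ∗ |υ|` as arithmetic functions -/

/-- `|υ|` as a real arithmetic function (`υ = μ ∗ μχ`, `upsilonOf`). [folklore] -/
def upsAbs : ArithmeticFunction ℝ :=
  ⟨fun n => |upsilonOf χ n|, by simp⟩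

/-- Unfolding lemma for `upsAbs`. [folklore] -/
theorem upsAbs_apply (n : ℕ) : upsAbs χ n = |upsilonOf χ n| := rfl

/-- The manuscript's majorant `∑_{n = lm} ν(l)|υ(m)| = (ν ∗ |υ|)(n)` as an arithmetic function.
[cite: Zhang2022LandauSiegel, §3, proof of Lemma 3.6 ("|ς(n)| ≤ ∑_{n=lm} ν(l)|υ(m)|")] -/
def sigmaMajorant : ArithmeticFunction ℝ :=
  nuOf χ * upsAbs χ

/-- Unfolding lemma for `sigmaMajorant`. [folklore] -/
theorem sigmaMajorant_apply (n : ℕ) :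
    sigmaMajorant χ n = ∑ x ∈ n.divisorsAntidiagonal, nuOf χ x.1 * |upsilonOf χ x.2| := by
  rw [sigmaMajorant, mul_apply]; rfl

variable {χ}

/-- `υ` is multiplicative for a completely multiplicative `χ` with `χ(1) = 1`. [folklore] -/
theorem isMultiplicative_upsilonOf (hχ : ∀ m n, χ (m * n) = χ m * χ n) (hχ1 : χ 1 = 1) :
    (upsilonOf χ).IsMultiplicative :=
  isMultiplicative_moebius.intCast.mul
    (isMultiplicative_moebius.intCast.pmul (isMultiplicative_of_map_mul χ hχ hχ1))

/-- `ν = ζ ∗ χ` is multiplicative for a completely multiplicative `χ` with `χ(1) = 1`. [folklore] -/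
theorem isMultiplicative_nuOf (hχ : ∀ m n, χ (m * n) = χ m * χ n) (hχ1 : χ 1 = 1) :
    (nuOf χ).IsMultiplicative :=
  isMultiplicative_zeta.natCast.mul (isMultiplicative_of_map_mul χ hχ hχ1)

/-- `|υ|` is multiplicative. [folklore] -/
theorem isMultiplicative_upsAbs (hχ : ∀ m n, χ (m * n) = χ m * χ n) (hχ1 : χ 1 = 1) :
    (upsAbs χ).IsMultiplicative := by
  have hυ := isMultiplicative_upsilonOf hχ hχ1
  refine ⟨?_, ?_⟩
  · rw [upsAbs_apply, hυ.map_one, abs_one]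
  · intro m n hmn
    rw [upsAbs_apply, upsAbs_apply, upsAbs_apply, hυ.map_mul_of_coprime hmn, abs_mul]

/-- `ν ∗ |υ|` is multiplicative. [folklore] -/
theorem isMultiplicative_sigmaMajorant (hχ : ∀ m n, χ (m * n) = χ m * χ n) (hχ1 : χ 1 = 1) :
    (sigmaMajorant χ).IsMultiplicative :=
  (isMultiplicative_nuOf hχ hχ1).mul (isMultiplicative_upsAbs hχ hχ1)

/-- `ν ≥ 0` for a real completely multiplicative `χ` with `χ(1) = 1`, `|χ| ≤ 1` (from the tree's
`|υ| ≤ ν`). [folklore] -/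
theorem nuOf_nonneg (hχ : ∀ m n, χ (m * n) = χ m * χ n) (hχ1 : χ 1 = 1) (hχabs : ∀ n, |χ n| ≤ 1)
    (n : ℕ) : 0 ≤ nuOf χ n :=
  (abs_nonneg _).trans (abs_upsilonOf_le_nuOf χ hχ hχ1 hχabs n)

/-- `(ν ∗ |υ|)(n) ≥ 0`. [folklore] -/
theorem sigmaMajorant_nonneg (hχ : ∀ m n, χ (m * n) = χ m * χ n) (hχ1 : χ 1 = 1)
    (hχabs : ∀ n, |χ n| ≤ 1) (n : ℕ) : 0 ≤ sigmaMajorant χ n := by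
  rw [sigmaMajorant_apply]
  exact sum_nonneg fun x _ => mul_nonneg (nuOf_nonneg hχ hχ1 hχabs _) (abs_nonneg _)

/-! ### Values at prime powers -/

/-- `ν(p^{j+1}) = ν(pʲ) + χ(p)^{j+1}`. [folklore] -/
theorem nuOf_prime_pow_succ (hχ : ∀ m n, χ (m * n) = χ m * χ n) (hχ1 : χ 1 = 1) {p : ℕ}
    (hp : p.Prime) (j : ℕ) : nuOf χ (p ^ (j + 1)) = nuOf χ (p ^ j) + χ p ^ (j + 1) := by
  rw [nuOf_apply_prime_pow χ hχ hχ1 hp, nuOf_apply_prime_pow χ hχ hχ1 hp, sum_range_succ]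

/-- `ν(p) = 1 + χ(p)`. [folklore] -/
theorem nuOf_prime_pow_one (hχ : ∀ m n, χ (m * n) = χ m * χ n) (hχ1 : χ 1 = 1) {p : ℕ}
    (hp : p.Prime) : nuOf χ (p ^ 1) = 1 + χ p := by
  rw [nuOf_apply_prime_pow χ hχ hχ1 hp 1, sum_range_succ, sum_range_succ, sum_range_zero, zero_add,
    pow_zero, pow_one]

/-- `υ(p) = −1 − χ(p)`. [folklore] -/
theorem upsilonOf_prime (hχ1 : χ 1 = 1) {p : ℕ} (hp : p.Prime) :
    upsilonOf χ (p ^ 1) = -1 - χ p := by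
  rw [upsilonOf_apply_prime_pow χ hχ1 hp one_pos]; simp

/-- `υ(p²) = χ(p)`. [folklore] -/
theorem upsilonOf_prime_sq (hχ1 : χ 1 = 1) {p : ℕ} (hp : p.Prime) :
    upsilonOf χ (p ^ 2) = χ p := by
  rw [upsilonOf_apply_prime_pow χ hχ1 hp two_pos]; simp

/-- `υ(pʲ) = 0` for `j ≥ 3`. [folklore] -/
theorem upsilonOf_prime_pow_eq_zero (hχ1 : χ 1 = 1) {p : ℕ} (hp : p.Prime) {j : ℕ} (hj : 3 ≤ j) :
    upsilonOf χ (p ^ j) = 0 := by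
  rw [upsilonOf_apply_prime_pow χ hχ1 hp (show 0 < j by omega)]
  simp [show j ≠ 1 by omega, show j ≠ 2 by omega]

/-- The majorant at `pᵏ` as a sum over `i ≤ k` of `ν(pⁱ)|υ(p^{k−i})|`. [folklore] -/
theorem sigmaMajorant_prime_pow_eq_sum {p : ℕ} (hp : p.Prime) (k : ℕ) :
    sigmaMajorant χ (p ^ k) =
      ∑ i ∈ range (k + 1), nuOf χ (p ^ i) * |upsilonOf χ (p ^ (k - i))| := by
  rw [sigmaMajorant_apply,
    Nat.sum_divisorsAntidiagonal (fun a b => nuOf χ a * |upsilonOf χ b|),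
    Nat.sum_divisors_prime_pow hp]
  exact sum_congr rfl fun i hi => by
    rw [Nat.pow_div (Nat.le_of_lt_succ (mem_range.mp hi)) hp.pos]

/-- The majorant at `p`: `(ν ∗ |υ|)(p) = |υ(p)| + ν(p) = 2(1 + χ(p))` (`|χ(p)| ≤ 1`). [folklore] -/
theorem sigmaMajorant_prime (hχ : ∀ m n, χ (m * n) = χ m * χ n) (hχ1 : χ 1 = 1)
    (hχabs : ∀ n, |χ n| ≤ 1) {p : ℕ} (hp : p.Prime) :
    sigmaMajorant χ (p ^ 1) = 2 * (1 + χ p) := by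
  have hυ := isMultiplicative_upsilonOf hχ hχ1
  have hν := isMultiplicative_nuOf hχ hχ1
  have hc := abs_le.mp (hχabs p)
  rw [sigmaMajorant_prime_pow_eq_sum hp 1, sum_range_succ, sum_range_succ, sum_range_zero, zero_add,
    Nat.sub_zero, Nat.sub_self, pow_zero, hν.map_one, hυ.map_one, abs_one, mul_one, one_mul,
    upsilonOf_prime hχ1 hp, nuOf_prime_pow_one hχ hχ1 hp,
    abs_of_nonpos (show -1 - χ p ≤ 0 by linarith)]
  ring

/-- The majorant at `p^{k'+2}`: only `i = k', k'+1, k'+2` contribute (`υ(pʲ) = 0` for `j ≥ 3`):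
`(ν ∗ |υ|)(p^{k'+2}) = ν(p^{k'})|χ(p)| + ν(p^{k'+1})(1 + χ(p)) + ν(p^{k'+2})`. [folklore] -/
theorem sigmaMajorant_prime_pow_two_add (hχ : ∀ m n, χ (m * n) = χ m * χ n) (hχ1 : χ 1 = 1)
    (hχabs : ∀ n, |χ n| ≤ 1) {p : ℕ} (hp : p.Prime) (k' : ℕ) :
    sigmaMajorant χ (p ^ (k' + 2)) =
      nuOf χ (p ^ k') * |χ p| + nuOf χ (p ^ (k' + 1)) * (1 + χ p) + nuOf χ (p ^ (k' + 2)) := by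
  have hυ := isMultiplicative_upsilonOf hχ hχ1
  have hc := abs_le.mp (hχabs p)
  have e0 : |upsilonOf χ (p ^ (k' + 2 - (k' + 2)))| = 1 := by
    rw [Nat.sub_self, pow_zero, hυ.map_one, abs_one]
  have e1 : |upsilonOf χ (p ^ (k' + 2 - (k' + 1)))| = 1 + χ p := by
    rw [show k' + 2 - (k' + 1) = 1 by omega, upsilonOf_prime hχ1 hp,
      abs_of_nonpos (show -1 - χ p ≤ 0 by linarith)]
    ring
  have e2 : |upsilonOf χ (p ^ (k' + 2 - k'))| = |χ p| := by
    rw [show k' + 2 - k' = 2 by omega, upsilonOf_prime_sq hχ1 hp]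
  have erest : ∀ i ∈ range k', nuOf χ (p ^ i) * |upsilonOf χ (p ^ (k' + 2 - i))| = 0 := by
    intro i hi
    have hi' := mem_range.mp hi
    rw [upsilonOf_prime_pow_eq_zero hχ1 hp (show 3 ≤ k' + 2 - i by omega), abs_zero, mul_zero]
  rw [sigmaMajorant_prime_pow_eq_sum hp (k' + 2), sum_range_succ, sum_range_succ, sum_range_succ,
    sum_eq_zero erest, zero_add, e0, e1, e2, mul_one]

/-- **The majorant at prime powers: `(ν ∗ |υ|)(pᵏ) ≤ (k+1)·ν(pᵏ) = τ(pᵏ)ν(pᵏ)`** for `k ≥ 1` and a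
real completely multiplicative `χ` with `χ(1) = 1`, `|χ| ≤ 1`.  With `c = χ(p)`, `a = ν(p^{k−2})`,
`t = c^{k−1}` (`k ≥ 2`): the left side is `a|c| + (a+t)(1+c) + (a+t+ct)`; for `c < 0` this is
exactly `2ν(pᵏ)`; for `c ≥ 0` it is `≤ 4ν(pᵏ)` when `k ≥ 3`, and `k = 2` is
`2 + 4c + 2c² ≤ 3(1 + c + c²)`; `k = 1` is `2(1+c) = 2ν(p)`.
[cite: Zhang2022LandauSiegel, §3, proof of Lemma 3.6 ("≤ ν(n)τ₂(n)")] -/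
theorem sigmaMajorant_prime_pow_le (hχ : ∀ m n, χ (m * n) = χ m * χ n) (hχ1 : χ 1 = 1)
    (hχabs : ∀ n, |χ n| ≤ 1) {p : ℕ} (hp : p.Prime) {k : ℕ} (hk : 0 < k) :
    sigmaMajorant χ (p ^ k) ≤ (k + 1 : ℝ) * nuOf χ (p ^ k) := by
  have hc := abs_le.mp (hχabs p)
  have hν := isMultiplicative_nuOf hχ hχ1
  rcases Nat.lt_or_ge k 2 with hk2 | hk2
  · -- `k = 1`
    obtain rfl : k = 1 := by omega
    rw [sigmaMajorant_prime hχ hχ1 hχabs hp, nuOf_prime_pow_one hχ hχ1 hp]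
    push_cast
    linarith
  · -- `k = k' + 2`
    obtain ⟨k', rfl⟩ : ∃ k', k = k' + 2 := ⟨k - 2, by omega⟩
    rw [sigmaMajorant_prime_pow_two_add hχ hχ1 hχabs hp k']
    have hb : nuOf χ (p ^ (k' + 1)) = nuOf χ (p ^ k') + χ p ^ (k' + 1) :=
      nuOf_prime_pow_succ hχ hχ1 hp k'
    have hd : nuOf χ (p ^ (k' + 2)) =
        nuOf χ (p ^ k') + χ p ^ (k' + 1) + χ p * χ p ^ (k' + 1) := by
      rw [show k' + 2 = (k' + 1) + 1 from rfl, nuOf_prime_pow_succ hχ hχ1 hp (k' + 1), hb,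
        pow_succ (χ p) (k' + 1)]
      ring
    have ha0 : 0 ≤ nuOf χ (p ^ k') := nuOf_nonneg hχ hχ1 hχabs _
    have hd0 : 0 ≤ nuOf χ (p ^ k') + χ p ^ (k' + 1) + χ p * χ p ^ (k' + 1) := by
      rw [← hd]; exact nuOf_nonneg hχ hχ1 hχabs _
    have hk0 : (0 : ℝ) ≤ k' := Nat.cast_nonneg k'
    rw [hb, hd]
    push_cast
    rcases lt_or_ge (χ p) 0 with hneg | hpos
    · -- `c < 0`: the left side is `2ν(p^{k'+2})`
      rw [abs_of_neg hneg]
      have h1 := mul_nonneg hk0 hd0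
      nlinarith [h1, hd0]
    · -- `c ≥ 0`
      rw [abs_of_nonneg hpos]
      have ht0 : 0 ≤ χ p ^ (k' + 1) := pow_nonneg hpos _
      have hct : 0 ≤ χ p * χ p ^ (k' + 1) := mul_nonneg hpos ht0
      rcases Nat.eq_zero_or_pos k' with hk' | hk'
      · -- `k = 2`: `a = 1`, `t = c`
        simp only [hk', pow_zero, hν.map_one, zero_add, pow_one, Nat.cast_zero]
        nlinarith [sq_nonneg (χ p - 1), hpos]
      · -- `k ≥ 3`
        have hk1 : (1 : ℝ) ≤ k' := Nat.one_le_cast.mpr hk'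
        have h1 := mul_nonneg ha0 (show (0 : ℝ) ≤ 1 - χ p by linarith)
        have h2 := mul_nonneg (show (0 : ℝ) ≤ (k' : ℝ) - 1 by linarith) ha0
        have h3 := mul_nonneg hk0 ht0
        have h4 := mul_nonneg hk0 hct
        nlinarith [h1, h2, h3, h4, ha0, ht0, hct]

/-! ### The majorant for all `n`: `(ν ∗ |υ|)(n) ≤ τ(n)ν(n)` -/

/-- **`∑_{n = lm} ν(l)|υ(m)| ≤ τ(n)ν(n)` for every `n`** (both sides multiplicative; prime powers by
`sigmaMajorant_prime_pow_le`). [cite: Zhang2022LandauSiegel, §3, proof of Lemma 3.6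
("∑_{n=lm} ν(l)|υ(m)| ≤ ν(n)τ₂(n)")] -/
theorem sigmaMajorant_le_card_mul_nuOf (hχ : ∀ m n, χ (m * n) = χ m * χ n) (hχ1 : χ 1 = 1)
    (hχabs : ∀ n, |χ n| ≤ 1) (n : ℕ) :
    sigmaMajorant χ n ≤ (n.divisors.card : ℝ) * nuOf χ n := by
  rcases eq_or_ne n 0 with rfl | hn
  · simp
  have hg : (((sigma 0 : ArithmeticFunction ℕ) : ArithmeticFunction ℝ).pmul
      (nuOf χ)).IsMultiplicative :=
    (isMultiplicative_sigma (k := 0)).natCast.pmul (isMultiplicative_nuOf hχ hχ1)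
  have key := abs_le_of_isMultiplicative (isMultiplicative_sigmaMajorant hχ hχ1) hg
    (fun p k hp hk => by
      rw [pmul_apply, natCoe_apply, sigma_zero_apply_prime_pow hp,
        abs_of_nonneg (sigmaMajorant_nonneg hχ hχ1 hχabs _)]
      push_cast
      exact sigmaMajorant_prime_pow_le hχ hχ1 hχabs hp hk) n hn
  rw [pmul_apply, natCoe_apply, sigma_zero_apply] at key
  exact (le_abs_self _).trans key

/-! ### The printed majorant of `ς` and its consequences for `∑ ς(n)²/n` -/

/-- `|ς_Y(n)| ≤ (ν ∗ |υ|)(n)`: the truncation `l, m ≤ Y` only drops terms, and `ν ≥ 0`.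
[cite: Zhang2022LandauSiegel, §3, proof of Lemma 3.6 ("|ς(n)| ≤ ∑_{n=lm} ν(l)|υ(m)|")] -/
theorem abs_sigmaTrunc_le_sigmaMajorant (hχ : ∀ m n, χ (m * n) = χ m * χ n) (hχ1 : χ 1 = 1)
    (hχabs : ∀ n, |χ n| ≤ 1) (Y n : ℕ) :
    |sigmaTrunc (nuOf χ) (upsilonOf χ) Y n| ≤ sigmaMajorant χ n := by
  have hν := nuOf_nonneg hχ hχ1 hχabs
  unfold sigmaTrunc
  rw [sigmaMajorant_apply]
  calc |∑ x ∈ n.divisorsAntidiagonal with x.1 ≤ Y ∧ x.2 ≤ Y, nuOf χ x.1 * upsilonOf χ x.2|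
      ≤ ∑ x ∈ n.divisorsAntidiagonal with x.1 ≤ Y ∧ x.2 ≤ Y, |nuOf χ x.1 * upsilonOf χ x.2| :=
        abs_sum_le_sum_abs _ _
    _ = ∑ x ∈ n.divisorsAntidiagonal with x.1 ≤ Y ∧ x.2 ≤ Y, nuOf χ x.1 * |upsilonOf χ x.2| :=
        sum_congr rfl fun x _ => by rw [abs_mul, abs_of_nonneg (hν _)]
    _ ≤ ∑ x ∈ n.divisorsAntidiagonal, nuOf χ x.1 * |upsilonOf χ x.2| :=
        sum_le_sum_of_subset_of_nonneg (filter_subset _ _)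
          fun x _ _ => mul_nonneg (hν _) (abs_nonneg _)

/-- **The printed majorant `|ς(n)| ≤ ν(n)τ₂(n)`** (every cut `Y`, every `n`).
[cite: Zhang2022LandauSiegel, §3, proof of Lemma 3.6] -/
theorem abs_sigmaTrunc_le_card_mul_nuOf (hχ : ∀ m n, χ (m * n) = χ m * χ n) (hχ1 : χ 1 = 1)
    (hχabs : ∀ n, |χ n| ≤ 1) (Y n : ℕ) :
    |sigmaTrunc (nuOf χ) (upsilonOf χ) Y n| ≤ (n.divisors.card : ℝ) * nuOf χ n :=
  (abs_sigmaTrunc_le_sigmaMajorant hχ hχ1 hχabs Y n).trans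
    (sigmaMajorant_le_card_mul_nuOf hχ hχ1 hχabs n)

/-- Squared: `ς(n)² ≤ τ(n)²ν(n)²`. [cite: Zhang2022LandauSiegel, §3, proof of Lemma 3.6] -/
theorem sigmaTrunc_sq_le (hχ : ∀ m n, χ (m * n) = χ m * χ n) (hχ1 : χ 1 = 1)
    (hχabs : ∀ n, |χ n| ≤ 1) (Y n : ℕ) :
    sigmaTrunc (nuOf χ) (upsilonOf χ) Y n ^ 2 ≤ (n.divisors.card : ℝ) ^ 2 * nuOf χ n ^ 2 := by
  have h := abs_sigmaTrunc_le_card_mul_nuOf hχ hχ1 hχabs Y n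
  have h2 : |sigmaTrunc (nuOf χ) (upsilonOf χ) Y n| ^ 2 ≤ ((n.divisors.card : ℝ) * nuOf χ n) ^ 2 :=
    pow_le_pow_left₀ (abs_nonneg _) h 2
  rw [sq_abs, mul_pow] at h2
  exact h2

/-- **The manuscript's step `∑ ς(n)²/n ≤ ∑ ν(n)²τ₂(n)²/n`** (over any finite set of `n`; in the
source `D⁴ < n ≤ x ≤ D⁸`, after which "the first assertion of Lemma 3.2" is applied).
[cite: Zhang2022LandauSiegel, §3, proof of Lemma 3.6] -/
theorem sum_sigmaTrunc_sq_div_le_sum_card_sq_mul_nuOf_sq (hχ : ∀ m n, χ (m * n) = χ m * χ n)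
    (hχ1 : χ 1 = 1) (hχabs : ∀ n, |χ n| ≤ 1) (Y : ℕ) (S : Finset ℕ) :
    ∑ n ∈ S, sigmaTrunc (nuOf χ) (upsilonOf χ) Y n ^ 2 / n ≤
      ∑ n ∈ S, (n.divisors.card : ℝ) ^ 2 * nuOf χ n ^ 2 / n :=
  sum_le_sum fun n _ => div_le_div_of_nonneg_right (sigmaTrunc_sq_le hχ hχ1 hχabs Y n)
    (Nat.cast_nonneg n)

end RealMultiplicative

/-! ### The quadratic Dirichlet character instance: the left side of the printed Lemma 3.2 -/

section Character

/-- For a quadratic Dirichlet character `χ` mod `D` (restricted to `ℕ` as `reChar χ`), any cut `Y`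
and any finite set `S`: `∑_{n∈S} ς(n)²/n ≤ ∑_{n∈S} ‖ν_χ(n)‖²τ(n)²/n` — the right side in the shape
of the tree's printed Lemma 3.2 (`Lemma32Cond.lemma_3_2_conditional`).
[cite: Zhang2022LandauSiegel, §3, proof of Lemma 3.6] -/
theorem sum_sigmaTrunc_sq_div_le_printedMajorant {D : ℕ} (χ : DirichletCharacter ℂ D)
    (hχ2 : χ ^ 2 = 1) (Y : ℕ) (S : Finset ℕ) :
    ∑ n ∈ S, sigmaTrunc (nuOf (reChar χ)) (upsilonOf (reChar χ)) Y n ^ 2 / n ≤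
      ∑ n ∈ S, ‖divisorSumChar χ n‖ ^ 2 * (n.divisors.card : ℝ) ^ 2 / n := by
  have h := sum_sigmaTrunc_sq_div_le_sum_card_sq_mul_nuOf_sq (reChar_mul_all χ hχ2) (reChar_one χ)
    (abs_reChar_le_one χ) Y S
  refine h.trans (le_of_eq (sum_congr rfl fun n _ => ?_))
  rw [nuOf_reChar_sq_eq χ hχ2 n]
  ring

/-! ### The input of Lemma 3.6 by the PRINTED route (conditional on the `L`-size binder) -/

/-- **The input `E = ∑_{D⁴ < n ≤ D⁸} ς(n)²/n ≤ C·𝓛⁻²⁰⁰⁷` of Lemma 3.6 by the manuscript's route**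
(majorant `|ς| ≤ ντ₂` + the printed Lemma 3.2), hence under the printed Lemma 3.2's `L`-size
hypothesis on `re s = ¾`: `Lemma32Cond.LBound χ κ b C_L` with `κ < 1/8` (the tree's
`lemma_3_2_conditional`).  Hypotheses otherwise: `χ` primitive mod `D`, `χ² = 1`, `log D ≥ 3`, (A).
[cite: Zhang2022LandauSiegel, §3, Lemma 3.2 + proof of Lemma 3.6] -/
theorem lemma_3_6_input_printed_of_LBound {κ : ℝ} (hκ : κ < 1 / 8) (b : ℕ) {CL : ℝ}
    (hCL : 0 ≤ CL) :
    ∃ C : ℝ, ∀ (D : ℕ) [NeZero D] (χ : DirichletCharacter ℂ D),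
    χ.IsPrimitive → χ ^ 2 = 1 → 3 ≤ Real.log D →
    ‖χ.LFunction 1‖ ≤ 1 / Real.log D ^ 2022 → LBound χ κ b CL →
      ∑ n ∈ Ioc (D ^ 4) (D ^ 8),
        sigmaTrunc (nuOf (reChar χ)) (upsilonOf (reChar χ)) (D ^ 4) n ^ 2 / n ≤
          C / Real.log D ^ 2007 := by
  obtain ⟨C, hC⟩ := lemma_3_2_conditional hκ b hCL
  refine ⟨C, fun D _ χ hprim hχ2 hL hA hLB => ?_⟩
  have hN : ((D ^ 8 : ℕ) : ℝ) ≤ (D : ℝ) ^ 8 := (Nat.cast_pow D 8).le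
  exact (sum_sigmaTrunc_sq_div_le_printedMajorant χ hχ2 (D ^ 4) (Ioc (D ^ 4) (D ^ 8))).trans
    (hC D χ hprim hχ2 hL hA hLB (D ^ 8) hN)

/-- **The same from a CRITICAL-LINE bound of any exponent `0 ≤ μ < ¼`** (`HalfLineBound χ μ b C₀`:
`‖L(½+it,χ)‖ ≤ C₀D^μ(1+|t|)^b`; Burgess `μ = 3/16+ε`, Weyl `μ = 1/6+ε`; the tree's
`lemma_3_2_of_halfLineBound`, Phragmén–Lindelöf to `re s = ¾`).  This is the manuscript's route to the
input of Lemma 3.6 end to end, the published subconvex bound entering as a binder.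
[cite: Zhang2022LandauSiegel, §3, Lemma 3.2 + proof of Lemma 3.6] -/
theorem lemma_3_6_input_printed_of_halfLineBound {μ : ℝ} (hμ0 : 0 ≤ μ) (hμ : μ < 1 / 4) (b : ℕ)
    {C₀ : ℝ} (hC₀ : 0 < C₀) :
    ∃ C : ℝ, ∀ (D : ℕ) [NeZero D] (χ : DirichletCharacter ℂ D),
    χ.IsPrimitive → χ ^ 2 = 1 → 3 ≤ Real.log D →
    ‖χ.LFunction 1‖ ≤ 1 / Real.log D ^ 2022 → HalfLineBound χ μ b C₀ →
      ∑ n ∈ Ioc (D ^ 4) (D ^ 8),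
        sigmaTrunc (nuOf (reChar χ)) (upsilonOf (reChar χ)) (D ^ 4) n ^ 2 / n ≤
          C / Real.log D ^ 2007 := by
  obtain ⟨C, hC⟩ := lemma_3_2_of_halfLineBound hμ0 hμ b hC₀
  refine ⟨C, fun D _ χ hprim hχ2 hL hA hHL => ?_⟩
  have hN : ((D ^ 8 : ℕ) : ℝ) ≤ (D : ℝ) ^ 8 := (Nat.cast_pow D 8).le
  exact (sum_sigmaTrunc_sq_div_le_printedMajorant χ hχ2 (D ^ 4) (Ioc (D ^ 4) (D ^ 8))).trans
    (hC D χ hprim hχ2 hL hA hHL (D ^ 8) hN)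

/-- **The same with the hypothesis in the printed shape of Burgess's theorem**
[IwaniecKowalski2004, Thm 12.9]: `BurgessShape χ ε C` (`‖L(s,χ)‖ ≤ C‖s‖D^{3/16+ε}` on `re s = ½`),
any `0 ≤ ε < 1/16`.  Thm 12.9 itself is NOT a theorem of Mathlib or of this tree and is NOT asserted.
[cite: Zhang2022LandauSiegel, §3, Lemma 3.2 + proof of Lemma 3.6; IwaniecKowalski2004, Thm 12.9
(shape of the binder only)] -/
theorem lemma_3_6_input_printed_of_burgessShape {ε : ℝ} (hε0 : 0 ≤ ε) (hε : ε < 1 / 16) {C₁ : ℝ}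
    (hC₁ : 0 < C₁) :
    ∃ C : ℝ, ∀ (D : ℕ) [NeZero D] (χ : DirichletCharacter ℂ D),
    χ.IsPrimitive → χ ^ 2 = 1 → 3 ≤ Real.log D →
    ‖χ.LFunction 1‖ ≤ 1 / Real.log D ^ 2022 → BurgessShape χ ε C₁ →
      ∑ n ∈ Ioc (D ^ 4) (D ^ 8),
        sigmaTrunc (nuOf (reChar χ)) (upsilonOf (reChar χ)) (D ^ 4) n ^ 2 / n ≤
          C / Real.log D ^ 2007 := by
  obtain ⟨C, hC⟩ := lemma_3_2_of_burgessShape hε0 hε hC₁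
  refine ⟨C, fun D _ χ hprim hχ2 hL hA hB => ?_⟩
  have hN : ((D ^ 8 : ℕ) : ℝ) ≤ (D : ℝ) ^ 8 := (Nat.cast_pow D 8).le
  exact (sum_sigmaTrunc_sq_div_le_printedMajorant χ hχ2 (D ^ 4) (Ioc (D ^ 4) (D ^ 8))).trans
    (hC D χ hprim hχ2 hL hA hB (D ^ 8) hN)

/-! ### The two routes side by side -/

/-- **The two routes to the input of Lemma 3.6, side by side.**  The SAME inequality
`∑_{D⁴ < n ≤ D⁸} ς(n)²/n ≤ C·(log D)⁻²⁰⁰⁷` for primitive quadratic `χ` mod `D` with `log D ≥ 3`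
under (A):
(i) WITHOUT any `L`-size hypothesis — the tree's `Lemma36Input.lemma_3_6_input'` (ALT-1 variant A11:
`ν ∗ υ = δ`, Cauchy, the four-`L`-factor moment `Section3Lemma32Flat` inside the convexity range);
(ii) by the manuscript's printed route — `lemma_3_6_input_printed_of_halfLineBound`, CONDITIONAL on
a critical-line bound `HalfLineBound χ μ b C₀` with `μ < ¼` (the subconvex input of the sketched
proof of Lemma 3.2; with the convexity exponent `μ = ¼` the interpolated exponent is `κ = 1/8`, the
boundary excluded by `lemma_3_2_conditional` — the cell's flag F7).  Verdict-neutral.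
[cite: Zhang2022LandauSiegel, §3, Lemmas 3.2, 3.6] -/
theorem lemma_3_6_input_two_routes {μ : ℝ} (hμ0 : 0 ≤ μ) (hμ : μ < 1 / 4) (b : ℕ) {C₀ : ℝ}
    (hC₀ : 0 < C₀) :
    (∃ C : ℝ, ∀ (D : ℕ) [NeZero D] (χ : DirichletCharacter ℂ D),
      χ.IsPrimitive → χ ^ 2 = 1 → 3 ≤ Real.log D →
      ‖χ.LFunction 1‖ ≤ 1 / Real.log D ^ 2022 →
        ∑ n ∈ Ioc (D ^ 4) (D ^ 8),
          sigmaTrunc (nuOf (reChar χ)) (upsilonOf (reChar χ)) (D ^ 4) n ^ 2 / n ≤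
            C / Real.log D ^ 2007) ∧
    (∃ C : ℝ, ∀ (D : ℕ) [NeZero D] (χ : DirichletCharacter ℂ D),
      χ.IsPrimitive → χ ^ 2 = 1 → 3 ≤ Real.log D →
      ‖χ.LFunction 1‖ ≤ 1 / Real.log D ^ 2022 → HalfLineBound χ μ b C₀ →
        ∑ n ∈ Ioc (D ^ 4) (D ^ 8),
          sigmaTrunc (nuOf (reChar χ)) (upsilonOf (reChar χ)) (D ^ 4) n ^ 2 / n ≤
            C / Real.log D ^ 2007) :=
  ⟨lemma_3_6_input', lemma_3_6_input_printed_of_halfLineBound hμ0 hμ b hC₀⟩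

end Character

end Literature.NumberTheory.LFunctions.Zhang2022.SigmaMajorant

end
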